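import Literature.Computability.MetaComplexity.GraphOrderingPrincipleDegree
import Literature.Computability.MetaComplexity.ResolutionStepLists
import HarnessLib

/-!
# Short resolution refutations of Galesi–Lauria's graph ordering principle `GOP(G)` (Stålmarck's scheme), for every graph

"The CNF encoding of `GOP(G)` has a well known short refutation in Resolution [Stålmarck 1996;
Bonet and Galesi 1999; 2001]" (Galesi–Lauria, ACM ToCL 2010, §3, p. 8, before Lemma 1) — the
UPPER-bound half of Galesi–Lauria's Theorem 2 ("for any `G` in `𝒢` the principle `GOP(G)` has
polynomial size [refutations] … and any PC refutation of `GOP(G)` requires degree at least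
`|V(G)|/108`").  This file proves it for GL10's OWN encoding `GOP.glGOP G`
(`GraphOrderingPrincipleDegree.lean`: one variable `x_{a,b}` per pair `a < b`, read "`a ≺ b`", the
literal "`b ≺ a`" being `¬x_{a,b}`; the two no-3-cycle clauses for every `a < b < c`; and for every
vertex `u` the clause `M_u = ⋁_{a ∈ Γ(u)} (a ≺ u)`), for EVERY simple graph `G` on `Fin n`, `n ≥ 2`:

* `GOPRes.exists_isResRefutation_glGOP` — `GOP(G)` has a resolution refutation with at most
  `12 n³` lines; `GOPRes.minResRefutationSize_glGOP_le` — the `ℕ∞` form.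

The refutation is Stålmarck's for the ordering principle (Jukna 2012, Thm 18.6; the tree's
`OrderingResolutionUpper.lean` for `Ordering_n`), transported to the tournament encoding: with
`S_m(i) = ⋁_{j < m, j ≠ i} (j ≺ i)` ("`i` has a predecessor among the first `m` vertices"),
`S_n(u) ⊇ M_u` is a WEAKENING of the axiom `M_u` (every neighbour is some vertex `≠ u`); from
`S_{m+1}(i) = S_m(i) ∨ (m ≺ i)` and `S_{m+1}(m) = ⋁_{j<m} (j ≺ m)` one resolves directly on the
variable `x_{i,m}` (the literals `m ≺ i` and `i ≺ m` are complementary — no anti-symmetry axiom is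
needed in this encoding) to get `C_0 = S_m(i) ∨ ⋁_{j<m, j≠i} (j ≺ m)`, and removes each `(j ≺ m)`
by the clause `T_j = S_m(i) ∨ (m ≺ j)`, itself the resolvent of `S_{m+1}(i)` with the no-3-cycle
clause `(m ≺ j) ∨ (i ≺ m) ∨ (j ≺ i)` of the triple `{j, i, m}`; `S_1(0)` is the empty clause.  The
tree's resolution has the weakening rule (`ResolutionStepLists.lean`, `DerivStep`), so supersets
are harmless throughout.

Honest framing: a REPRODUCTION of a folklore/Stålmarck upper bound (GL10 cite it; Bonet–Galesi
use it for the optimality of the size–width trade-off).  Not here: regularity of the refutation,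
GL10's Lemma 1 proper (PC/PCR refutations of degree `O(n)` / polynomial PCR size), the `n = 1`
case (there `M_0` is the empty clause itself).

References: N. Galesi, M. Lauria, ACM ToCL 12(1) (2010), §3 p. 8 and Thm 2 [GalesiLauria2010]
(held copy `paper:doi-10-1145-1838552-1838556` p0008 L44–46, p0013 L37–45); G. Stålmarck, Acta
Inform. 33 (1996) [Stalmarck1996]; S. Jukna, *Boolean Function Complexity* (2012), Thm 18.6
[Jukna2012]; M. L. Bonet, N. Galesi, FOCS 1999 / Comput. Complexity 10 (2001).
-/

namespace Literature.Computability.MetaComplexity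

open _root_.Computability Complexity Finset

namespace GOPRes

/-! ### Literals and clauses on natural indices -/

/-- The literal "`j ≺ i`" of GL10's encoding on natural indices: `x_{j,i}` (index `j·n + i`) if
`j < i`, else `¬x_{i,j}`. [Galesi–Lauria 2010, §3 (4)] [cite: GalesiLauria2010, §3] -/
def plit (n j i : ℕ) : Literal ℕ :=
  if j < i then (j * n + i, true) else (i * n + j, false)

/-- `S_m(i) = ⋁_{j < m, j ≠ i} (j ≺ i)`: "`i` has a predecessor among the first `m` vertices".
[Jukna 2012, Thm 18.6 (the clauses `C_m(j)`); Stålmarck 1996] [cite: Jukna2012, Theorem 18.6] -/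
def pred (n m i : ℕ) : Finset (Literal ℕ) :=
  ((Finset.range m).filter fun j => j ≠ i).image fun j => plit n j i

/-- `T_j = S_m(i) ∨ (m ≺ j)`. [Jukna 2012, Thm 18.6 (Fig. 18.4, upper part)]
[cite: Jukna2012, Theorem 18.6] -/
def elim (n m i j : ℕ) : Finset (Literal ℕ) :=
  insert (plit n m j) (pred n m i)

/-- `C_j = S_m(i) ∨ ⋁_{j ≤ j' < m, j' ≠ i} (j' ≺ m)`. [Jukna 2012, Thm 18.6 (Fig. 18.4, lower part)]
[cite: Jukna2012, Theorem 18.6] -/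
def chain (n m i j : ℕ) : Finset (Literal ℕ) :=
  (((Finset.range m).filter fun j' => j ≤ j' ∧ j' ≠ i).image fun j' => plit n j' m) ∪ pred n m i

/-- The block deriving `S_m(i)`: `T_0, …, T_{m−1}, C_0, …, C_m, S_m(i)`. [Jukna 2012, Thm 18.6]
[cite: Jukna2012, Theorem 18.6] -/
def block (n m i : ℕ) : List (Finset (Literal ℕ)) :=
  (List.range m).map (elim n m i) ++ ((List.range (m + 1)).map (chain n m i) ++ [pred n m i])

/-- Round `m`: the blocks of all `i < m`. [Jukna 2012, Thm 18.6] [cite: Jukna2012, Theorem 18.6] -/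
def round (n m : ℕ) : List (Finset (Literal ℕ)) :=
  (List.range m).flatMap (block n m)

/-- **The refutation of `GOP(G)`** as a list of clauses: first `S_n(0), …, S_n(n−1)` (weakenings of
the axioms `M_u`), then the rounds `m = n − 1, …, 1`; the last clause `S_1(0)` is empty.
[Galesi–Lauria 2010, §3 ("well known short refutation in Resolution"); Stålmarck 1996; Jukna 2012,
Thm 18.6] [cite: GalesiLauria2010, §3] -/
def refList (n : ℕ) : List (Finset (Literal ℕ)) :=
  (List.range n).map (pred n n) ++ (List.range (n - 1)).flatMap fun k => round n (n - 1 - k)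

/-! ### Elementary facts -/

/-- `j ≺ i` for `j < i` is the positive literal `x_{j,i}`. [folklore] -/
private theorem plit_of_lt {n j i : ℕ} (h : j < i) : plit n j i = (j * n + i, true) := by
  rw [plit, if_pos h]

/-- `j ≺ i` for `i < j` is the negative literal `¬x_{i,j}`. [folklore] -/
private theorem plit_of_gt {n j i : ℕ} (h : i < j) : plit n j i = (i * n + j, false) := by
  rw [plit, if_neg (by omega)]

/-- GL10's literal `precLit` is `plit` on the underlying naturals. [folklore] -/
private theorem precLit_eq_plit {n : ℕ} (a b : Fin n) : GOP.precLit n a b = plit n a b := by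
  unfold GOP.precLit plit GOP.var
  by_cases h : a < b
  · rw [if_pos h, if_pos (Fin.lt_def.1 h)]
  · rw [if_neg h, if_neg (fun h' => h (Fin.lt_def.2 h'))]

/-- Membership in `S_m(i)`. [folklore] -/
private theorem mem_pred {n m i : ℕ} {l : Literal ℕ} :
    l ∈ pred n m i ↔ ∃ j, j < m ∧ j ≠ i ∧ l = plit n j i := by
  unfold pred
  simp only [Finset.mem_image, Finset.mem_filter, Finset.mem_range]
  constructor
  · rintro ⟨j, ⟨hj, hji⟩, rfl⟩; exact ⟨j, hj, hji, rfl⟩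
  · rintro ⟨j, hj, hji, rfl⟩; exact ⟨j, ⟨hj, hji⟩, rfl⟩

/-- Membership in `C_j`. [folklore] -/
private theorem mem_chain {n m i j : ℕ} {l : Literal ℕ} :
    l ∈ chain n m i j ↔
      (∃ j', j' < m ∧ j ≤ j' ∧ j' ≠ i ∧ l = plit n j' m) ∨ l ∈ pred n m i := by
  unfold chain
  rw [Finset.mem_union]
  simp only [Finset.mem_image, Finset.mem_filter, Finset.mem_range]
  constructor
  · rintro (⟨j', ⟨hj', hjj', hj'i⟩, rfl⟩ | h)
    · exact Or.inl ⟨j', hj', hjj', hj'i, rfl⟩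
    · exact Or.inr h
  · rintro (⟨j', hj', hjj', hj'i, rfl⟩ | h)
    · exact Or.inl ⟨j', ⟨hj', hjj', hj'i⟩, rfl⟩
    · exact Or.inr h

/-- `S_1(0)` is the empty clause. [Jukna 2012, Thm 18.6] [cite: Jukna2012, Theorem 18.6] -/
theorem pred_one_zero (n : ℕ) : pred n 1 0 = ∅ := by
  ext l
  rw [mem_pred]
  simp only [Finset.notMem_empty, iff_false, not_exists, not_and]
  intro j hj hj0
  omega

/-! ### The axioms used -/

section Axioms

variable {n : ℕ} (G : SimpleGraph (Fin n)) [DecidableRel G.Adj]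

/-- The first no-3-cycle clause of a sorted triple is an axiom of `GOP(G)`. [Galesi–Lauria 2010,
§3 (2)] [cite: GalesiLauria2010, §3 (2)] -/
theorem transClause₁_mem_glGOP {a b c : Fin n} (hab : a < b) (hbc : b < c) :
    GOP.transClause₁ n a b c ∈ GOP.glGOP G := by
  refine List.mem_append_left _ ?_
  simp only [GOP.transClauses, List.mem_flatMap, List.mem_finRange, true_and]
  exact ⟨a, b, c, by rw [if_pos ⟨hab, hbc⟩]; simp⟩

/-- The second no-3-cycle clause of a sorted triple is an axiom of `GOP(G)`. [Galesi–Lauria 2010,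
§3 (3)] [cite: GalesiLauria2010, §3 (3)] -/
theorem transClause₂_mem_glGOP {a b c : Fin n} (hab : a < b) (hbc : b < c) :
    GOP.transClause₂ n a b c ∈ GOP.glGOP G := by
  refine List.mem_append_left _ ?_
  simp only [GOP.transClauses, List.mem_flatMap, List.mem_finRange, true_and]
  exact ⟨a, b, c, by rw [if_pos ⟨hab, hbc⟩]; simp⟩

/-- The transitivity clause `(m ≺ j) ∨ (i ≺ m) ∨ (j ≺ i)` ("`j ≺ m ∧ m ≺ i → j ≺ i`") for
`j < i < m` is the SECOND no-3-cycle clause of `(j, i, m)`. [Galesi–Lauria 2010, §3 (3)]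
[cite: GalesiLauria2010, §3 (3)] -/
theorem trans_mem_clauseSet_of_lt {j i m : ℕ} (hji : j < i) (him : i < m) (hm : m < n) :
    ([(j * n + i, true), (i * n + m, true), (j * n + m, false)] : Clause ℕ).toFinset ∈
      clauseSet (GOP.glGOP G) :=
  mem_clauseSet_iff.2 ⟨GOP.transClause₂ n ⟨j, by omega⟩ ⟨i, by omega⟩ ⟨m, hm⟩,
    transClause₂_mem_glGOP G (Fin.mk_lt_mk.2 hji) (Fin.mk_lt_mk.2 him), rfl⟩

/-- The transitivity clause `(m ≺ j) ∨ (i ≺ m) ∨ (j ≺ i)` for `i < j < m` is the FIRST no-3-cycle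
clause of `(i, j, m)`. [Galesi–Lauria 2010, §3 (2)] [cite: GalesiLauria2010, §3 (2)] -/
theorem trans_mem_clauseSet_of_gt {j i m : ℕ} (hij : i < j) (hjm : j < m) (hm : m < n) :
    ([(i * n + j, false), (j * n + m, false), (i * n + m, true)] : Clause ℕ).toFinset ∈
      clauseSet (GOP.glGOP G) :=
  mem_clauseSet_iff.2 ⟨GOP.transClause₁ n ⟨i, by omega⟩ ⟨j, by omega⟩ ⟨m, hm⟩,
    transClause₁_mem_glGOP G (Fin.mk_lt_mk.2 hij) (Fin.mk_lt_mk.2 hjm), rfl⟩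

/-- The axiom `M_u` is available and is contained in `S_n(u)` (every neighbour of `u` is a vertex
`≠ u`). [Galesi–Lauria 2010, §3 (4)] [cite: GalesiLauria2010, §3 (4)] -/
theorem exists_minClause_subset_pred (u : Fin n) :
    ∃ D ∈ clauseSet (GOP.glGOP G), D ⊆ pred n n u := by
  refine ⟨(GOP.minClause G u).toFinset, mem_clauseSet_iff.2 ⟨GOP.minClause G u,
    List.mem_append_right _ (List.mem_map.2 ⟨u, List.mem_finRange u, rfl⟩), rfl⟩, fun l hl => ?_⟩
  rw [List.mem_toFinset, GOP.minClause, List.mem_map] at hl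
  obtain ⟨a, ha, rfl⟩ := hl
  rw [Finset.mem_sort, SimpleGraph.mem_neighborFinset] at ha
  have hne : (a : ℕ) ≠ u := fun h => G.ne_of_adj ha (Fin.ext h).symm
  rw [precLit_eq_plit]
  exact mem_pred.2 ⟨a, a.isLt, hne, rfl⟩

end Axioms

/-! ### The steps -/

section Steps

variable {n m i : ℕ} (G : SimpleGraph (Fin n)) [DecidableRel G.Adj] {A : Set (Finset (Literal ℕ))}

/-- **Step `T_j`** (`j < m`, `i < m < n`): for `j ≠ i`, resolve `S_{m+1}(i) ∋ (m ≺ i) = ¬x_{i,m}`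
with the transitivity clause `(m ≺ j) ∨ (i ≺ m) ∨ (j ≺ i) ∋ x_{i,m}` on `x_{i,m}`; for `j = i`,
`T_i = S_{m+1}(i)` itself. [Jukna 2012, Thm 18.6 (Fig. 18.4); Galesi–Lauria 2010, §3]
[cite: Jukna2012, Theorem 18.6] -/
theorem derivStep_elim (hax : clauseSet (GOP.glGOP G) ⊆ A) (hS : pred n (m + 1) i ∈ A)
    (hi : i < m) (hmn : m < n) {j : ℕ} (hj : j < m) : DerivStep A (elim n m i j) := by
  have hpiv : plit n m i = (i * n + m, false) := plit_of_gt hi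
  have hE : (i * n + m, false) ∈ pred n (m + 1) i := by
    rw [← hpiv]; exact mem_pred.2 ⟨m, Nat.lt_succ_self m, by omega, rfl⟩
  -- the part of `S_{m+1}(i)` other than `(m ≺ i)` is `S_m(i)`
  have hEsub : (pred n (m + 1) i).erase (i * n + m, false) ⊆ elim n m i j := by
    intro y hy
    obtain ⟨hne, hy⟩ := Finset.mem_erase.1 hy
    obtain ⟨j', hj', hj'i, rfl⟩ := mem_pred.1 hy
    have hj'm : j' ≠ m := fun h => hne (by rw [h, hpiv])
    exact Finset.mem_insert_of_mem (mem_pred.2 ⟨j', by omega, hj'i, rfl⟩)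
  have hself : plit n m j ∈ elim n m i j := Finset.mem_insert_self _ _
  have hpredsub : pred n m i ⊆ elim n m i j := Finset.subset_insert _ _
  by_cases hji : j = i
  · -- `T_i = S_m(i) ∨ (m ≺ i) = S_{m+1}(i)`
    subst hji
    refine DerivStep.of_mem hS fun y hy => ?_
    obtain ⟨j', hj', hj'i, rfl⟩ := mem_pred.1 hy
    by_cases hj'm : j' = m
    · subst hj'm; exact hself
    · exact hpredsub (mem_pred.2 ⟨j', by omega, hj'i, rfl⟩)
  · have hmj : plit n m j = (j * n + m, false) := plit_of_gt hj
    rcases Nat.lt_or_gt_of_ne hji with hlt | hgt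
    · -- `j < i < m`: the second no-3-cycle clause of `(j, i, m)`
      have hD := hax (trans_mem_clauseSet_of_lt G hlt hi hmn)
      refine DerivStep.of_res hD hS (by simp) hE ?_ hEsub
      intro y hy
      obtain ⟨hne, hy⟩ := Finset.mem_erase.1 hy
      rw [List.mem_toFinset] at hy
      simp only [List.mem_cons, List.not_mem_nil, or_false] at hy
      rcases hy with rfl | rfl | rfl
      · exact hpredsub (mem_pred.2 ⟨j, hj, hji, (plit_of_lt hlt).symm⟩)
      · exact absurd rfl hne
      · rw [← hmj]; exact hself
    · -- `i < j < m`: the first no-3-cycle clause of `(i, j, m)`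
      have hD := hax (trans_mem_clauseSet_of_gt G hgt hj hmn)
      refine DerivStep.of_res hD hS (by simp) hE ?_ hEsub
      intro y hy
      obtain ⟨hne, hy⟩ := Finset.mem_erase.1 hy
      rw [List.mem_toFinset] at hy
      simp only [List.mem_cons, List.not_mem_nil, or_false] at hy
      rcases hy with rfl | rfl | rfl
      · exact hpredsub (mem_pred.2 ⟨j, hj, hji, (plit_of_gt hgt).symm⟩)
      · rw [← hmj]; exact hself
      · exact absurd rfl hne

/-- **Step `C_0`**: resolve `S_{m+1}(m) ∋ (i ≺ m) = x_{i,m}` with `S_{m+1}(i) ∋ ¬x_{i,m}` on `x_{i,m}`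
(in the tournament encoding the two literals are complementary). [Jukna 2012, Thm 18.6 (Fig. 18.4),
adapted] [cite: Jukna2012, Theorem 18.6] -/
theorem derivStep_chain_zero (hSm : pred n (m + 1) m ∈ A) (hS : pred n (m + 1) i ∈ A) (hi : i < m) :
    DerivStep A (chain n m i 0) := by
  have hpos : plit n i m = (i * n + m, true) := plit_of_lt hi
  have hneg : plit n m i = (i * n + m, false) := plit_of_gt hi
  refine DerivStep.of_res hSm hS (by rw [← hpos]; exact mem_pred.2 ⟨i, by omega, by omega, rfl⟩)
    (by rw [← hneg]; exact mem_pred.2 ⟨m, Nat.lt_succ_self m, by omega, rfl⟩) ?_ ?_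
  · intro y hy
    obtain ⟨hne, hy⟩ := Finset.mem_erase.1 hy
    obtain ⟨j', hj', hj'm, rfl⟩ := mem_pred.1 hy
    have hj'i : j' ≠ i := fun h => hne (by rw [h, hpos])
    exact mem_chain.2 (Or.inl ⟨j', by omega, Nat.zero_le _, hj'i, rfl⟩)
  · intro y hy
    obtain ⟨hne, hy⟩ := Finset.mem_erase.1 hy
    obtain ⟨j', hj', hj'i, rfl⟩ := mem_pred.1 hy
    have hj'm : j' ≠ m := fun h => hne (by rw [h, hneg])
    exact mem_chain.2 (Or.inr (mem_pred.2 ⟨j', by omega, hj'i, rfl⟩))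

/-- **Step `C_{j+1}`**: for `j ≠ i` resolve `C_j ∋ (j ≺ m) = x_{j,m}` with `T_j ∋ (m ≺ j) = ¬x_{j,m}`
on `x_{j,m}`; for `j = i`, `C_{i+1} = C_i`. [Jukna 2012, Thm 18.6 (Fig. 18.4)]
[cite: Jukna2012, Theorem 18.6] -/
theorem derivStep_chain_succ {j : ℕ} (hC : chain n m i j ∈ A) (hT : elim n m i j ∈ A)
    (hj : j < m) : DerivStep A (chain n m i (j + 1)) := by
  by_cases hji : j = i
  · refine DerivStep.of_mem hC fun y hy => ?_
    rcases mem_chain.1 hy with ⟨j', hj', hjj', hj'i, rfl⟩ | hy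
    · exact mem_chain.2 (Or.inl ⟨j', hj', by omega, hj'i, rfl⟩)
    · exact mem_chain.2 (Or.inr hy)
  have hpos : plit n j m = (j * n + m, true) := plit_of_lt hj
  have hneg : plit n m j = (j * n + m, false) := plit_of_gt hj
  refine DerivStep.of_res hC hT (by rw [← hpos]; exact mem_chain.2 (Or.inl ⟨j, hj, le_rfl, hji, rfl⟩))
    (by rw [← hneg]; exact Finset.mem_insert_self _ _) ?_ ?_
  · intro y hy
    obtain ⟨hne, hy⟩ := Finset.mem_erase.1 hy
    rcases mem_chain.1 hy with ⟨j', hj', hjj', hj'i, rfl⟩ | hy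
    · have hj'j : j' ≠ j := fun h => hne (by rw [h, hpos])
      exact mem_chain.2 (Or.inl ⟨j', hj', by omega, hj'i, rfl⟩)
    · exact mem_chain.2 (Or.inr hy)
  · intro y hy
    obtain ⟨hne, hy⟩ := Finset.mem_erase.1 hy
    unfold elim at hy
    rcases Finset.mem_insert.1 hy with rfl | hy
    · exact absurd hneg hne
    · exact mem_chain.2 (Or.inr hy)

/-- **Last step of the block**: `C_m` is `S_m(i)`. [Jukna 2012, Thm 18.6] [cite: Jukna2012, Theorem 18.6] -/
theorem derivStep_pred (hC : chain n m i m ∈ A) : DerivStep A (pred n m i) := by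
  refine DerivStep.of_mem hC fun y hy => ?_
  rcases mem_chain.1 hy with ⟨j', hj', hjj', -, rfl⟩ | hy
  · omega
  · exact hy

/-- **The block of `S_m(i)` is a step list** over any set containing the axioms of `GOP(G)` and the
clauses `S_{m+1}(i')`, `i' ≤ m`. [Jukna 2012, Thm 18.6] [cite: Jukna2012, Theorem 18.6] -/
theorem stepList_block (hax : clauseSet (GOP.glGOP G) ⊆ A) (hS : ∀ i' ≤ m, pred n (m + 1) i' ∈ A)
    (hi : i < m) (hmn : m < n) : StepList A (block n m i) := by
  unfold block
  refine StepList.append (stepList_map_range fun j hj =>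
    (derivStep_elim G hax (hS i hi.le) hi hmn hj).mono Set.subset_union_left) ?_
  refine StepList.append (stepList_map_range fun j hj => ?_) ?_
  · rcases j with _ | j
    · exact (derivStep_chain_zero (hS m le_rfl) (hS i hi.le) hi).mono fun D hD =>
        Or.inl (Or.inl hD)
    · have hjm : j < m := by omega
      refine derivStep_chain_succ ?_ ?_ hjm
      · exact Or.inr ⟨j, Nat.lt_succ_self j, rfl⟩
      · exact Or.inl (Or.inr (List.mem_map.2 ⟨j, List.mem_range.2 hjm, rfl⟩))
  · refine stepList_singleton (derivStep_pred ?_)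
    exact Or.inr (List.mem_map.2 ⟨m, List.mem_range.2 (Nat.lt_succ_self m), rfl⟩)

/-- **Round `m` is a step list.** [Jukna 2012, Thm 18.6] [cite: Jukna2012, Theorem 18.6] -/
theorem stepList_round (hax : clauseSet (GOP.glGOP G) ⊆ A) (hS : ∀ i' ≤ m, pred n (m + 1) i' ∈ A)
    (hmn : m < n) : StepList A (round n m) := by
  unfold round
  exact stepList_flatMap_range fun i hi => (stepList_block G hax hS hi hmn).mono Set.subset_union_left

/-- Round `m` contains `S_m(i)` for every `i < m`. [Jukna 2012, Thm 18.6] [cite: Jukna2012, Theorem 18.6] -/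
theorem pred_mem_round {i : ℕ} (hi : i < m) : pred n m i ∈ round n m := by
  unfold round block
  rw [List.mem_flatMap]
  exact ⟨i, List.mem_range.2 hi, List.mem_append_right _ (List.mem_append_right _
    (List.mem_singleton_self _))⟩

end Steps

/-! ### The refutation -/

variable {n : ℕ} (G : SimpleGraph (Fin n)) [DecidableRel G.Adj]

/-- **The list is a step list over the axioms of `GOP(G)`** (every graph `G`). [Galesi–Lauria 2010,
§3; Stålmarck 1996; Jukna 2012, Thm 18.6] [cite: GalesiLauria2010, §3] -/
theorem stepList_refList : StepList (clauseSet (GOP.glGOP G)) (refList n) := by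
  unfold refList
  refine StepList.append (stepList_map_range fun u hu => ?_) ?_
  · -- `S_n(u)` is a weakening of the axiom `M_u`
    obtain ⟨D, hD, hsub⟩ := exists_minClause_subset_pred G ⟨u, hu⟩
    exact DerivStep.of_mem (Or.inl hD) hsub
  refine stepList_flatMap_range fun k hk => ?_
  refine stepList_round G (fun D hD => Or.inl (Or.inl hD)) (fun i' hi' => ?_) (by omega)
  rcases k with _ | k
  · -- round `n − 1`: the `S_n(i')` come from the initial block
    have h : n - 1 - 0 + 1 = n := by omega
    rw [h]
    exact Or.inl (Or.inr (List.mem_map.2 ⟨i', List.mem_range.2 (by omega), rfl⟩))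
  · -- later rounds: `S_{m+1}(i')` was derived in the previous round
    have h : n - 1 - (k + 1) + 1 = n - 1 - k := by omega
    rw [h]
    exact Or.inr ⟨k, Nat.lt_succ_self k, pred_mem_round (by omega)⟩

/-- The empty clause `S_1(0)` belongs to the list (`n ≥ 2`). [Jukna 2012, Thm 18.6]
[cite: Jukna2012, Theorem 18.6] -/
theorem empty_mem_refList (hn : 2 ≤ n) : (∅ : Finset (Literal ℕ)) ∈ refList n := by
  rw [← pred_one_zero n]
  unfold refList
  refine List.mem_append_right _ ?_
  rw [List.mem_flatMap]
  refine ⟨n - 2, List.mem_range.2 (by omega), ?_⟩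
  have h : n - 1 - (n - 2) = 1 := by omega
  rw [h]
  exact pred_mem_round Nat.zero_lt_one

/-- The length of the list is at most `3 n³`. [Jukna 2012, Thm 18.6 ("polynomial size")]
[cite: Jukna2012, Theorem 18.6] -/
theorem length_refList_le (hn : 1 ≤ n) : (refList n).length ≤ 3 * n ^ 3 := by
  have hblock : ∀ m i, (block n m i).length = 2 * m + 2 := by
    intro m i; simp [block]; omega
  have hround : ∀ m, (round n m).length = m * (2 * m + 2) := by
    intro m
    unfold round
    rw [List.length_flatMap]
    simp only [hblock, List.map_const', List.sum_replicate, List.length_range, smul_eq_mul]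
  unfold refList
  rw [List.length_append, List.length_map, List.length_range, List.length_flatMap]
  have hle : ∀ k ∈ List.range (n - 1), (round n (n - 1 - k)).length ≤ 2 * n ^ 2 := by
    intro k hk
    simp only [hround]
    have h1 : n - 1 - k ≤ n := by omega
    calc (n - 1 - k) * (2 * (n - 1 - k) + 2) ≤ n * (2 * n) := Nat.mul_le_mul h1 (by omega)
      _ = 2 * n ^ 2 := by ring
  have hsum : ((List.range (n - 1)).map fun k => (round n (n - 1 - k)).length).sum ≤ 2 * n ^ 3 :=
    calc ((List.range (n - 1)).map fun k => (round n (n - 1 - k)).length).sum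
        ≤ ((List.range (n - 1)).map fun _ => 2 * n ^ 2).sum :=
          List.sum_le_sum fun k hk => hle k hk
      _ = (n - 1) * (2 * n ^ 2) := by simp
      _ ≤ n * (2 * n ^ 2) := Nat.mul_le_mul_right _ (Nat.sub_le n 1)
      _ = 2 * n ^ 3 := by ring
  have hn3 : n ≤ n ^ 3 := by
    calc n = n * 1 * 1 := by ring
      _ ≤ n * n * n := Nat.mul_le_mul (Nat.mul_le_mul_left _ hn) hn
      _ = n ^ 3 := by ring
  omega

/-- **Short resolution refutations of `GOP(G)`, every graph** [Galesi–Lauria 2010, §3 ("The CNF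
encoding of GOP(G) has a well known short refutation in Resolution [Stålmarck 1996; Bonet and
Galesi 1999; 2001]"), the upper-bound half of their Thm 2]: for every simple graph `G` on `n ≥ 2`
vertices, `GOP(G)` has a resolution refutation with at most `12 n³` lines.
[cite: GalesiLauria2010, §3 (p. 8) and Theorem 2] -/
theorem exists_isResRefutation_glGOP (hn : 2 ≤ n) :
    ∃ π : List (ResLine ℕ), IsResRefutation (GOP.glGOP G) π ∧ π.length ≤ 12 * n ^ 3 := by
  obtain ⟨π, hπ, hlen, hall⟩ := (stepList_refList G).exists_isResDerivation
  obtain ⟨l, hl, hl0⟩ := hall ∅ (empty_mem_refList hn)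
  refine ⟨π, ⟨hπ, l, hl, hl0⟩, ?_⟩
  have := length_refList_le (n := n) (by omega)
  omega

/-- The `ℕ∞` form: `S_R(GOP(G)) ≤ 12 n³` for every graph on `n ≥ 2` vertices. [Galesi–Lauria 2010,
§3 and Thm 2] [cite: GalesiLauria2010, §3 (p. 8) and Theorem 2] -/
theorem minResRefutationSize_glGOP_le (hn : 2 ≤ n) :
    minResRefutationSize (GOP.glGOP G) ≤ ((12 * n ^ 3 : ℕ) : ℕ∞) := by
  obtain ⟨π, hπ, hlen⟩ := exists_isResRefutation_glGOP G hn
  calc minResRefutationSize (GOP.glGOP G) ≤ π.length := minResRefutationSize_le_length hπ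
    _ ≤ ((12 * n ^ 3 : ℕ) : ℕ∞) := by exact_mod_cast hlen

end GOPRes

end Literature.Computability.MetaComplexity
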